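import Mathlib.Analysis.Meromorphic.Order
import Mathlib.NumberTheory.LSeries.Basic
import Literature.NumberTheory.GaloisRepresentations.ArtinLFunction
import HarnessLib

/-!
# Additive twists of a Dirichlet series and their regularised values

Topic `Literature/NumberTheory/LFunctions`; requested (definition item `defn-LSeries.addTwistValue`)
by route `Langlands/EvenArtinQuantumBoundary`, whose items `QuantumRigidity`,
`GaloisBoundaryBounded`, `BoundaryNecessity`, `BoundaryValuesAlgebraic` inline the `∃ D`-clause
below four times.

For a coefficient sequence `a : ℕ → ℂ` and a rational `x`, the **additive twist** of the Dirichlet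
series `∑ aₙ n^{-s}` is `D_a(s; x) = ∑_{n ≥ 1} aₙ e(nx) n^{-s}`, `e(t) = exp(2πit)` — Mathlib's
`LSeries` of the twisted sequence `addTwistCoeff a x = (n ↦ aₙ e(nx))` (Booker 2003, eq. (4):
`L(s, ρ, α) = ∑ aₙ e(-nα) n^{-s}`, i.e. `D_a(s; -α)`; Bettin–Conrey 2013 for `aₙ = d(n)`, the
Estermann function, whose value at `s = 0` is a cotangent sum; Nordentoft 2021 for cusp forms).
Its **regularised value at `s₀`** is the value at `s₀` of a meromorphic continuation to `ℂ` that is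
analytic at `s₀`:

* `LSeries.HasAddTwistValue a x s₀ v` — VERBATIM the route's clause
  `∃ D : ℂ → ℂ, MeromorphicOn D univ ∧ AnalyticAt ℂ D s₀ ∧ D s₀ = v ∧ ∀ s, 1 < Re s → D s = D_a(s;x)`;
* `LSeries.addTwistValue a x s₀ : ℂ` — THE regularised value (`Classical.choose`; junk `0` when no
  such continuation exists), characterised by `HasAddTwistValue.addTwistValue_eq`;
* uniqueness `HasAddTwistValue.unique` (PROVED: two meromorphic functions on `ℂ` agreeing on the
  half-plane `Re s > 1` have order `⊤` difference everywhere, by the identity principle for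
  meromorphic functions on the preconnected plane,
  `MeromorphicOn.meromorphicOrderAt_ne_top_of_isPreconnected`, and a function analytic at `s₀` that
  vanishes on a punctured neighbourhood vanishes at `s₀`);
* the NAMED FACT `Booker2003_lemma1` (Booker, Ann. of Math. 158 (2003), Lemma 1, p. 1092: for the
  paper's irreducible even `ρ : Γ_ℚ → GL₂(ℂ)` and rational `α`, `L(s, ρ, α)` "has meromorphic
  continuation to the complex plane, with poles possible only in the strip `0 < Re s < 1`") and its
  PROVED consequence `Booker2003_lemma1.hasAddTwistValue`: for such `ρ` with Dirichlet coefficients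
  `a`, `HasAddTwistValue a x s₀ (addTwistValue a x s₀)` for every rational `x` and every `s₀` with
  `Re s₀ ≤ 0` or `Re s₀ ≥ 1` — the existence statement the route uses at `s₀ = 0` and `s₀ = -k`.

## Design choices / junk analysis

* `HasAddTwistValue` asks for a continuation meromorphic on ALL of `ℂ` (the route's clause), so even
  for `Re s₀ > 1` it is a genuine condition (a general Dirichlet series need not continue); when it
  holds, the value is the obvious one (`HasAddTwistValue.eq_LSeries`). Mathlib's `MeromorphicOn`
  tolerates junk values on a discrete set; the clause pins the value at `s₀` by `AnalyticAt`.
* `e(nx)` is written `Complex.exp (2 * Real.pi * Complex.I * (n : ℂ) * ((x : ℚ) : ℂ))`, the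
  route's term, so that the route's four clauses are `HasAddTwistValue a x 0 u` etc. by `Iff.rfl`;
  `addTwistCoeff` is `1`-periodic in `x` (`addTwistCoeff_add_one`), whence so are all notions here.
* Booker's Lemma 1 is vendored for the `ρ` of his §"Proof for even representations": irreducible,
  `2`-dimensional, over `ℚ`, even (hypotheses of the route's items; his standing "icosahedral" is a
  without-loss-of-generality reduction by Langlands–Tunnell and is not assumed; the proof printed —
  stability of the span of the `q^{-s} L(s, ρ ⊗ χ₀)` under twists by `c/p^m` — uses only that the
  `ρ ⊗ χ₀` are irreducible and non-trivial). The clause "expressible as the ratio of two entire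
  functions of order 1" is omitted (no finite-order predicate in Mathlib); "poles possible only in
  `0 < Re s < 1`" is rendered as analyticity of the continuation at every `s` with `Re s ≤ 0` or
  `Re s ≥ 1`. The Dirichlet coefficients enter as in the route: `LSeries a s = artinLFunction ρ s`
  for `Re s > 1` (the tree's `artinLFunction` is the full Euler product, Booker's `L(s, ρ)`).
* Mathlib has `LSeries`, `MeromorphicOn`, `meromorphicOrderAt`, `AnalyticAt`; no additive twists
  (searched `addTwist`, `additive twist`, `Estermann`).

## References

* [Booker2003] A. R. Booker, *Poles of Artin L-functions and the strong Artin conjecture*, Ann. of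
  Math. 158 (2003), 1089–1098: eq. (4) p. 1091; Lemma 1 p. 1092 (proof pp. 1092–1093).
* [BettinConrey2013] S. Bettin, J. B. Conrey, *Period functions and cotangent sums*, Algebra Number
  Theory 7 (2013) (the case `aₙ = d(n)`).
* [Nordentoft2021] A. C. Nordentoft, *Central values of additive twists of cuspidal L-functions*,
  J. reine angew. Math. 776 (2021).
-/

noncomputable section

open Filter Topology Set

namespace Literature.NumberTheory.LFunctions

/-! ### The additive twist -/

/-- The **additively twisted coefficients** `n ↦ aₙ e(nx)`, `e(t) = exp(2πit)`, of a sequence `a`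
by a rational `x` (written with the term `Complex.exp (2 * π * I * n * x)` of route
`EvenArtinQuantumBoundary`). [cite: Booker2003, eq. (4) p. 1091] -/
def LSeries.addTwistCoeff (a : ℕ → ℂ) (x : ℚ) : ℕ → ℂ :=
  fun n : ℕ => a n * Complex.exp (2 * Real.pi * Complex.I * (n : ℂ) * ((x : ℚ) : ℂ))

/-- The **additive twist** `D_a(s; x) = ∑_{n ≥ 1} aₙ e(nx) n^{-s}` as a Dirichlet series (Mathlib
`LSeries`; the genuine value where the series converges, e.g. `Re s > 1` for `|aₙ| ≪ n^ε`, junk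
`0` elsewhere). Booker's `L(s, ρ, α)` is `D_a(s; -α)`. [cite: Booker2003, eq. (4) p. 1091] -/
def LSeries.addTwist (a : ℕ → ℂ) (x : ℚ) (s : ℂ) : ℂ :=
  LSeries (LSeries.addTwistCoeff a x) s

/-- Unfolding of `addTwistCoeff`. [folklore] -/
@[simp] theorem LSeries.addTwistCoeff_apply (a : ℕ → ℂ) (x : ℚ) (n : ℕ) :
    LSeries.addTwistCoeff a x n =
      a n * Complex.exp (2 * Real.pi * Complex.I * (n : ℂ) * ((x : ℚ) : ℂ)) :=
  rfl

/-- Unfolding of `addTwist`. [folklore] -/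
theorem LSeries.addTwist_eq (a : ℕ → ℂ) (x : ℚ) (s : ℂ) :
    LSeries.addTwist a x s = LSeries (LSeries.addTwistCoeff a x) s :=
  rfl

/-- The untwisted case: `D_a(s; 0)` is the Dirichlet series of `a`. [folklore] -/
@[simp] theorem LSeries.addTwistCoeff_zero (a : ℕ → ℂ) : LSeries.addTwistCoeff a 0 = a := by
  funext n
  simp [LSeries.addTwistCoeff]

/-- **Periodicity**: `e(n(x+1)) = e(nx)`, so the twisted coefficients only depend on `x mod 1`.
[folklore] -/
theorem LSeries.addTwistCoeff_add_one (a : ℕ → ℂ) (x : ℚ) :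
    LSeries.addTwistCoeff a (x + 1) = LSeries.addTwistCoeff a x := by
  funext n
  simp only [LSeries.addTwistCoeff]
  congr 1
  have h : (2 * Real.pi * Complex.I * (n : ℂ) * (((x + 1 : ℚ)) : ℂ)) =
      2 * Real.pi * Complex.I * (n : ℂ) * ((x : ℚ) : ℂ) + (n : ℂ) * (2 * Real.pi * Complex.I) := by
    push_cast
    ring
  rw [h, Complex.exp_add, Complex.exp_nat_mul_two_pi_mul_I, mul_one]

/-! ### Regularised values -/

/-- **`v` is the regularised value at `s₀` of the additive twist `D_a(·; x)`**: some function `D`,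
meromorphic on all of `ℂ` and ANALYTIC at `s₀`, agrees with `D_a(s; x) = ∑ aₙ e(nx) n^{-s}` on
the half-plane `Re s > 1` and takes the value `v` at `s₀`. This is verbatim the clause inlined in
the items `QuantumRigidity`, `GaloisBoundaryBounded`, `BoundaryNecessity`, `BoundaryValuesAlgebraic`
of route `Langlands/EvenArtinQuantumBoundary` (Booker's `f₀(s)`-type regularisation of `L(s, ρ, α)`;
Bettin–Conrey's `D(s, a/q)` at `s = 0`). The value is unique (`HasAddTwistValue.unique`).
[cite: Booker2003, Lemma 1 p. 1092] [cite: BettinConrey2013, §1] -/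
def LSeries.HasAddTwistValue (a : ℕ → ℂ) (x : ℚ) (s₀ v : ℂ) : Prop :=
  ∃ D : ℂ → ℂ, MeromorphicOn D Set.univ ∧ AnalyticAt ℂ D s₀ ∧ D s₀ = v ∧
    ∀ s : ℂ, 1 < s.re →
      D s = LSeries (fun n : ℕ => a n * Complex.exp (2 * Real.pi * Complex.I * (n : ℂ) *
        ((x : ℚ) : ℂ))) s

open Classical in
/-- **The regularised value `D_a(s₀; x)` of the additive twist** (the requested notion
`LSeries.addTwistValue`): the unique `v` with `HasAddTwistValue a x s₀ v` when there is one
(`HasAddTwistValue.addTwistValue_eq`), and the junk value `0` otherwise.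
[cite: Booker2003, Lemma 1 p. 1092] -/
def LSeries.addTwistValue (a : ℕ → ℂ) (x : ℚ) (s₀ : ℂ) : ℂ :=
  if h : ∃ v, LSeries.HasAddTwistValue a x s₀ v then h.choose else 0

namespace LSeries

variable {a : ℕ → ℂ} {x : ℚ} {s₀ v v' : ℂ}

/-- Unfolding of `HasAddTwistValue`, with the twist written as `addTwist a x`. [folklore] -/
theorem hasAddTwistValue_iff :
    HasAddTwistValue a x s₀ v ↔ ∃ D : ℂ → ℂ, MeromorphicOn D Set.univ ∧ AnalyticAt ℂ D s₀ ∧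
      D s₀ = v ∧ ∀ s : ℂ, 1 < s.re → D s = addTwist a x s :=
  Iff.rfl

/-- **Identity principle for continuations.** Two functions meromorphic on all of `ℂ` which agree
on the half-plane `Re s > 1` agree at every point where both are analytic: their difference has
meromorphic order `⊤` at `2` (it vanishes near `2`), hence everywhere on the preconnected plane
(`MeromorphicOn.meromorphicOrderAt_ne_top_of_isPreconnected`), i.e. it vanishes on a punctured
neighbourhood of `s₀`, and it is continuous at `s₀`. [folklore] -/
theorem eq_of_meromorphicOn_of_eqOn {D D' : ℂ → ℂ} (hD : MeromorphicOn D Set.univ)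
    (hD' : MeromorphicOn D' Set.univ) (h : ∀ s : ℂ, 1 < s.re → D s = D' s)
    (hs₀ : AnalyticAt ℂ D s₀) (hs₀' : AnalyticAt ℂ D' s₀) : D s₀ = D' s₀ := by
  set E : ℂ → ℂ := D - D' with hE
  have hEm : MeromorphicOn E Set.univ := hD.sub hD'
  -- `E` vanishes on the open half-plane `Re s > 1`, a neighbourhood of `2`
  have hE2 : meromorphicOrderAt E 2 = ⊤ := by
    rw [meromorphicOrderAt_eq_top_iff]
    have hopen : IsOpen {s : ℂ | 1 < s.re} := isOpen_lt continuous_const Complex.continuous_re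
    have hmem : {s : ℂ | 1 < s.re} ∈ 𝓝 (2 : ℂ) := hopen.mem_nhds (by norm_num)
    filter_upwards [nhdsWithin_le_nhds hmem] with s hs
    simp only [hE, Pi.sub_apply, h s hs, sub_self]
  -- hence `E` has order `⊤` everywhere (identity principle on the preconnected plane)
  have hEs₀ : meromorphicOrderAt E s₀ = ⊤ := by
    by_contra hne
    exact (hEm.meromorphicOrderAt_ne_top_of_isPreconnected isPreconnected_univ (mem_univ s₀)
      (mem_univ 2) hne) hE2
  -- `E` is continuous at `s₀` and vanishes on a punctured neighbourhood, so `E s₀ = 0`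
  rw [meromorphicOrderAt_eq_top_iff] at hEs₀
  have hcont : ContinuousAt E s₀ := (hs₀.sub hs₀').continuousAt
  have hlim : Tendsto E (𝓝[≠] s₀) (𝓝 (E s₀)) := hcont.continuousWithinAt.tendsto
  have hlim0 : Tendsto E (𝓝[≠] s₀) (𝓝 0) :=
    tendsto_const_nhds.congr' (hEs₀.mono fun _ h => h.symm)
  have h0 : E s₀ = 0 := tendsto_nhds_unique hlim hlim0
  simpa [hE, sub_eq_zero] using h0

/-- **Uniqueness of the regularised value.** [folklore] -/
theorem HasAddTwistValue.unique (h : HasAddTwistValue a x s₀ v) (h' : HasAddTwistValue a x s₀ v') :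
    v = v' := by
  obtain ⟨D, hD, hDs₀, rfl, hDL⟩ := h
  obtain ⟨D', hD', hD's₀, rfl, hD'L⟩ := h'
  exact eq_of_meromorphicOn_of_eqOn hD hD' (fun s hs => by rw [hDL s hs, hD'L s hs]) hDs₀ hD's₀

/-- If a regularised value at `s₀` exists, `addTwistValue a x s₀` has the defining property.
[folklore] -/
theorem hasAddTwistValue_addTwistValue (h : ∃ v, HasAddTwistValue a x s₀ v) :
    HasAddTwistValue a x s₀ (addTwistValue a x s₀) := by
  rw [addTwistValue, dif_pos h]
  exact h.choose_spec

/-- **Characterisation of `addTwistValue`**: any regularised value IS `addTwistValue a x s₀`.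
[folklore] -/
theorem HasAddTwistValue.addTwistValue_eq (h : HasAddTwistValue a x s₀ v) :
    addTwistValue a x s₀ = v :=
  (hasAddTwistValue_addTwistValue ⟨v, h⟩).unique h

/-- `HasAddTwistValue a x s₀ v ↔ (a value exists) ∧ v = addTwistValue a x s₀`. [folklore] -/
theorem hasAddTwistValue_iff_eq :
    HasAddTwistValue a x s₀ v ↔ (∃ w, HasAddTwistValue a x s₀ w) ∧ v = addTwistValue a x s₀ :=
  ⟨fun h => ⟨⟨v, h⟩, h.addTwistValue_eq.symm⟩,
    fun ⟨hex, hv⟩ => hv ▸ hasAddTwistValue_addTwistValue hex⟩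

/-- Junk value: with no continuation analytic at `s₀`, `addTwistValue a x s₀ = 0`. [folklore] -/
theorem addTwistValue_of_not_exists (h : ¬ ∃ v, HasAddTwistValue a x s₀ v) :
    addTwistValue a x s₀ = 0 := by
  rw [addTwistValue, dif_neg h]

/-- In the half-plane of convergence a regularised value is the value of the series:
`HasAddTwistValue a x s₀ v → 1 < Re s₀ → v = D_a(s₀; x)`. [folklore] -/
theorem HasAddTwistValue.eq_LSeries (h : HasAddTwistValue a x s₀ v) (hs₀ : 1 < s₀.re) :
    v = addTwist a x s₀ := by
  obtain ⟨D, -, -, rfl, hDL⟩ := h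
  exact hDL s₀ hs₀

/-- A continuation serving `s₀` serves every point where it is analytic: the same `D` witnesses
`HasAddTwistValue a x s₁ (D s₁)`. [folklore] -/
theorem hasAddTwistValue_of_continuation {D : ℂ → ℂ} (hD : MeromorphicOn D Set.univ)
    (hDL : ∀ s : ℂ, 1 < s.re → D s = addTwist a x s) {s₁ : ℂ} (hs₁ : AnalyticAt ℂ D s₁) :
    HasAddTwistValue a x s₁ (D s₁) :=
  ⟨D, hD, hs₁, rfl, hDL⟩

/-- Periodicity in `x`: regularised values only depend on `x mod 1`. [folklore] -/
theorem hasAddTwistValue_add_one_iff :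
    HasAddTwistValue a (x + 1) s₀ v ↔ HasAddTwistValue a x s₀ v := by
  have h : ∀ s, addTwist a (x + 1) s = addTwist a x s := fun s => by
    rw [addTwist, addTwist, addTwistCoeff_add_one]
  simp only [hasAddTwistValue_iff, h]

/-- Periodicity in `x` of `addTwistValue`. [folklore] -/
theorem addTwistValue_add_one : addTwistValue a (x + 1) s₀ = addTwistValue a x s₀ := by
  by_cases hex : ∃ v, HasAddTwistValue a x s₀ v
  · obtain ⟨v, hv⟩ := hex
    rw [hv.addTwistValue_eq, (hasAddTwistValue_add_one_iff.2 hv).addTwistValue_eq]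
  · rw [addTwistValue_of_not_exists hex, addTwistValue_of_not_exists]
    rintro ⟨v, hv⟩
    exact hex ⟨v, hasAddTwistValue_add_one_iff.1 hv⟩

end LSeries

/-! ### Booker 2003, Lemma 1 (named fact) and the existence of regularised values -/

/-- NAMED FACT (**Booker 2003, Lemma 1**, p. 1092: "Let `α` be a rational number. Then `L(s, ρ, α)`
has meromorphic continuation to the complex plane, with poles possible only in the strip
`0 < Re(s) < 1`, and is expressible as the ratio of two entire functions of order `1`", for the `ρ`
of §"Proof for even representations": an irreducible even representation `ρ : Γ_ℚ → GL₂(ℂ)`, and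
`L(s, ρ, α) = ∑ aₙ e(-nα) n^{-s}`, `aₙ` the Dirichlet coefficients of `L(s, ρ)`, eq. (4)). Lean: for
`σ : FramedArtinRep ℚ 2` irreducible and even (`det σ(c) = 1` at complex conjugations), `a` with
`LSeries a = artinLFunction σ` on `Re s > 1`, and every rational `x` (`= -α`), there is `D : ℂ → ℂ`
meromorphic on `ℂ`, analytic at every `s` with `Re s ≤ 0` or `Re s ≥ 1`, and equal to
`∑ aₙ e(nx) n^{-s}` on `Re s > 1`. The finite-order clause is omitted. Users take
`(h : Booker2003_lemma1)`. [cite: Booker2003, Lemma 1 p. 1092] -/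
def Booker2003_lemma1 : Prop :=
  ∀ (σ : Literature.NumberTheory.GaloisRepresentations.FramedArtinRep ℚ 2) (a : ℕ → ℂ),
    σ.toGaloisRep.IsIrreducible →
    (∀ (φ : ℚ →+* ℝ) (c : Field.absoluteGaloisGroup ℚ),
      Literature.NumberTheory.GaloisRepresentations.IsComplexConjugation φ c →
        Matrix.GeneralLinearGroup.det (σ c) = 1) →
    (∀ s : ℂ, 1 < s.re →
      LSeries a s = Literature.NumberTheory.GaloisRepresentations.artinLFunction σ.toArtinRep s) →
    ∀ x : ℚ, ∃ D : ℂ → ℂ, MeromorphicOn D Set.univ ∧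
      (∀ s : ℂ, s.re ≤ 0 ∨ 1 ≤ s.re → AnalyticAt ℂ D s) ∧
      ∀ s : ℂ, 1 < s.re →
        D s = LSeries (fun n : ℕ => a n * Complex.exp (2 * Real.pi * Complex.I * (n : ℂ) *
          ((x : ℚ) : ℂ))) s

/-- **Existence of regularised values for even Artin data** (consequence of Booker's Lemma 1, the
form used by route `EvenArtinQuantumBoundary` at `s₀ = 0` and `s₀ = -k`): for `σ` irreducible even,
`a` its Dirichlet coefficients, every rational `x` and every `s₀` with `Re s₀ ≤ 0` or `Re s₀ ≥ 1`,
the regularised value exists, i.e. `HasAddTwistValue a x s₀ (addTwistValue a x s₀)`.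
[cite: Booker2003, Lemma 1 p. 1092] -/
theorem Booker2003_lemma1.hasAddTwistValue (h : Booker2003_lemma1)
    {σ : Literature.NumberTheory.GaloisRepresentations.FramedArtinRep ℚ 2} {a : ℕ → ℂ}
    (hirr : σ.toGaloisRep.IsIrreducible)
    (heven : ∀ (φ : ℚ →+* ℝ) (c : Field.absoluteGaloisGroup ℚ),
      Literature.NumberTheory.GaloisRepresentations.IsComplexConjugation φ c →
        Matrix.GeneralLinearGroup.det (σ c) = 1)
    (ha : ∀ s : ℂ, 1 < s.re →
      LSeries a s = Literature.NumberTheory.GaloisRepresentations.artinLFunction σ.toArtinRep s)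
    (x : ℚ) {s₀ : ℂ} (hs₀ : s₀.re ≤ 0 ∨ 1 ≤ s₀.re) :
    LSeries.HasAddTwistValue a x s₀ (LSeries.addTwistValue a x s₀) := by
  obtain ⟨D, hD, hDan, hDL⟩ := h σ a hirr heven ha x
  exact LSeries.hasAddTwistValue_addTwistValue ⟨D s₀, D, hD, hDan s₀ hs₀, rfl, hDL⟩

/-- In particular (route items `QuantumRigidity`, `GaloisBoundaryBounded`, `BoundaryNecessity`): the
regularised value AT `s₀ = 0` exists for even Artin data. [cite: Booker2003, Lemma 1 p. 1092] -/
theorem Booker2003_lemma1.hasAddTwistValue_zero (h : Booker2003_lemma1)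
    {σ : Literature.NumberTheory.GaloisRepresentations.FramedArtinRep ℚ 2} {a : ℕ → ℂ}
    (hirr : σ.toGaloisRep.IsIrreducible)
    (heven : ∀ (φ : ℚ →+* ℝ) (c : Field.absoluteGaloisGroup ℚ),
      Literature.NumberTheory.GaloisRepresentations.IsComplexConjugation φ c →
        Matrix.GeneralLinearGroup.det (σ c) = 1)
    (ha : ∀ s : ℂ, 1 < s.re →
      LSeries a s = Literature.NumberTheory.GaloisRepresentations.artinLFunction σ.toArtinRep s)
    (x : ℚ) : LSeries.HasAddTwistValue a x 0 (LSeries.addTwistValue a x 0) :=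
  h.hasAddTwistValue hirr heven ha x (Or.inl (by simp))

/-- And at the non-positive integers `s₀ = -k` (route item `BoundaryValuesAlgebraic`).
[cite: Booker2003, Lemma 1 p. 1092] -/
theorem Booker2003_lemma1.hasAddTwistValue_neg_nat (h : Booker2003_lemma1)
    {σ : Literature.NumberTheory.GaloisRepresentations.FramedArtinRep ℚ 2} {a : ℕ → ℂ}
    (hirr : σ.toGaloisRep.IsIrreducible)
    (heven : ∀ (φ : ℚ →+* ℝ) (c : Field.absoluteGaloisGroup ℚ),
      Literature.NumberTheory.GaloisRepresentations.IsComplexConjugation φ c →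
        Matrix.GeneralLinearGroup.det (σ c) = 1)
    (ha : ∀ s : ℂ, 1 < s.re →
      LSeries a s = Literature.NumberTheory.GaloisRepresentations.artinLFunction σ.toArtinRep s)
    (x : ℚ) (k : ℕ) :
    LSeries.HasAddTwistValue a x (-(k : ℂ)) (LSeries.addTwistValue a x (-(k : ℂ))) :=
  h.hasAddTwistValue hirr heven ha x (Or.inl (by simp))

end Literature.NumberTheory.LFunctions

end
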